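import Literature.IUT.LogVolume.ProductVolume
import Literature.IUT.LogVolume.LocalFieldVolume
import HarnessLib

/-!
# Transport and invariance of normalised volumes along isomorphisms of integral structures

Classical Haar-measure facts behind the sentence "(Ind1), (Ind2) preserve log-volumes" — the first
clause of Step (x) of the proof of [IUTchIII] Cor. 3.12 (kurims p. 181 l. 5–13: "the procession-normalized
mono-analytic log-volumes … are invariant with respect to the indeterminacies (Ind1), (Ind2)"), the
named `Prop` `Summit.ABC.IUTFork.Thm311.MRData.LogvolInvariant` of the cell's Thm. 3.11 (i) file B
("NOT assumed anywhere; named so that instantiations state and prove it"), [IUTchIII] Prop. 3.9 (i)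
"invariant with respect to permutations" / (ii) "(Mono-analytic Compatibility) … relative to the natural
poly-isomorphisms", [IUTchIV] Thm. 1.10 Step (v), and Dupuy–Hilado §4.7 ((Ind1) "fixes the lattice"),
§4.9 footnote ((Ind2) "the measure of sets are preserved under these maps") — stated once for an ARBITRARY
locally compact abelian group with an integral structure (`NormalizedHaar.lean`), so that every concrete
container of the campaign (completions `K_v`, direct sums, tensor packets once topologised) gets them by
instantiation:

* TRANSPORT (`haar_image_equiv`, `logVolume_image_equiv`, `normalizedLogVolume_image_equiv`): a
  bicontinuous additive isomorphism `φ : V ≃ W` carrying the integral structure `Λ ⊆ V` ONTO the integral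
  structure `Λ' ⊆ W` carries `μ_Λ` to `μ_{Λ'}`: `μ_{Λ'}(φ(A)) = μ_Λ(A)` for EVERY set `A` (Haar uniqueness:
  `φ_* μ_Λ` is a regular Haar measure on `W` giving `Λ'` mass `1`). This is the shape of (Ind1) "the tensor
  packet with permuted index tuple is carried onto the tensor packet, fixing the lattice" and of Prop. 3.9
  (ii) "`μ_D(S) = μ_F(e(S))` for every member `e` of the poly-isomorphism".
* INVARIANCE UNDER LATTICE AUTOMORPHISMS (`haar_image_of_preserves`, log forms): an automorphism
  `φ : V ≃ V` that maps SOME integral structure `Λ₀` onto itself preserves `μ_Λ` for EVERY normalisation `Λ`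
  (the modulus of `φ` does not depend on the normalising lattice: `haar_image_self_eq`). This is the shape of
  (Ind2) at a finite prime in Dupuy–Hilado's reading ("`ℤ_p`-lattice isomorphisms of `I_v`": they fix the
  log-shell lattice `I_v`, not necessarily `O_v`, and still preserve the `O_v`-normalised measure) and of
  [AbsTopIII] Prop. 5.7 (i)(b) "if `x ∈ O_k^×`, then `μ^log_k(x·A) = μ^log_k(A)`".
* NEGATION (`haar_neg`, `logVolume_neg`): `μ_Λ(−A) = μ_Λ(A)` — (Ind2)'s `{±1}`.
* COROLLARIES for the containers already in the tree: the volume `μ_k` of a nonarchimedean local field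
  (`localVolume_image_of_preserves`, `localVolume_image_of_norm_map_eq`,
  `localVolume_image_equiv_of_norm_map_eq` — an additive homeomorphism between two local fields preserving
  the norm, e.g. a continuous field isomorphism that is an isometry, carries `μ_k` to `μ_{k'}`), and the weighted log-volume of direct product regions
  (`weightedLogVolume_image_of_preserves`: factorwise lattice automorphisms change nothing).

Everything here is a THEOREM of Mathlib's Haar measure (uniqueness `IntegralStructure.eq_haar`, the
scaling rule `IntegralStructure.haar_image`, negation invariance of Haar measures on abelian groups); no
IUT object and no disputed statement is involved — the files that instantiate (Ind1)/(Ind2) on concrete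
packets cite these lemmas. [cite: MochizukiAbsTopIII2015, Prop. 5.7 (i)(b) p. 138]
[cite: DupuyHilado2025, §4.7, §4.9] Deliberately NOT here: the tensor-packet topology (campaign S files),
the (Ind1)/(Ind2) families themselves (`Summits/ABC/IUTFork/Thm311Sig.lean`), any judgement on
[IUTchIII] Cor. 3.12.
-/

noncomputable section

open MeasureTheory MeasureTheory.Measure Set TopologicalSpace
open scoped ENNReal NNReal Pointwise

namespace Literature.IUT.LogVolume

namespace IntegralStructure

variable {V : Type*} [AddCommGroup V] [TopologicalSpace V] [IsTopologicalAddGroup V]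
  [MeasurableSpace V] [BorelSpace V]
variable {W : Type*} [AddCommGroup W] [TopologicalSpace W] [IsTopologicalAddGroup W]
  [MeasurableSpace W] [BorelSpace W]
variable (Λ : IntegralStructure V) (Λ' : IntegralStructure W)

/-! ### Transport along an isomorphism carrying `Λ` onto `Λ'` -/

omit [IsTopologicalAddGroup W] in
/-- The push-forward `φ_* μ_Λ` evaluated on a set: `(φ_* μ_Λ)(B) = μ_Λ(φ⁻¹(B))` for EVERY `B`
(`φ` is a measurable equivalence). [folklore] -/
private theorem map_haar_apply (φ : V ≃ₜ+ W) (B : Set W) : (Λ.haar.map φ) B = Λ.haar (φ ⁻¹' B) := by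
  change (Λ.haar.map φ.toHomeomorph.toMeasurableEquiv) B = _
  rw [MeasurableEquiv.map_apply]
  rfl

/-- **Haar transport**: if the bicontinuous additive isomorphism `φ : V ≃ W` carries the integral
structure `Λ` onto the integral structure `Λ'`, then `φ_* μ_Λ = μ_{Λ'}` (`φ_* μ_Λ` is a regular additive
Haar measure on `W` with `(φ_* μ_Λ)(Λ') = μ_Λ(Λ) = 1`; uniqueness of the normalised volume, "there exists a
unique map `μ_k` … (3) normalization"). [cite: MochizukiAbsTopIII2015, Prop. 5.7 (i)(a) p. 137] -/
theorem map_haar_eq_haar (φ : V ≃ₜ+ W) (hφ : φ '' (Λ : Set V) = (Λ' : Set W)) :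
    Λ.haar.map φ = Λ'.haar := by
  haveI : LocallyCompactSpace W := Λ'.locallyCompactSpace
  haveI : IsAddHaarMeasure (Λ.haar.map φ) := φ.isAddHaarMeasure_map Λ.haar
  haveI : (Λ.haar.map φ).Regular := Regular.map φ.toHomeomorph
  refine Λ'.eq_haar _ ?_
  rw [map_haar_apply, ← hφ, Set.preimage_image_eq _ φ.injective, haar_self]

/-- **Volumes are transported**: `μ_{Λ'}(φ(A)) = μ_Λ(A)` for every `A ⊆ V`, whenever `φ(Λ) = Λ'` — the
form in which an isomorphism of containers "fixing the lattice" identifies their normalised measures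
((Ind1): Dupuy–Hilado §4.7; [IUTchIII] Prop. 3.9 (ii) "compatible … relative to the natural
poly-isomorphisms"). [cite: DupuyHilado2025, §4.7] -/
theorem haar_image_equiv (φ : V ≃ₜ+ W) (hφ : φ '' (Λ : Set V) = (Λ' : Set W)) (A : Set V) :
    Λ'.haar (φ '' A) = Λ.haar A := by
  rw [← Λ.map_haar_eq_haar Λ' φ hφ, map_haar_apply, Set.preimage_image_eq _ φ.injective]

/-- Preimage form of the transport: `μ_Λ(φ⁻¹(B)) = μ_{Λ'}(B)` whenever `φ(Λ) = Λ'`.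
[cite: DupuyHilado2025, §4.7] -/
theorem haar_preimage_equiv (φ : V ≃ₜ+ W) (hφ : φ '' (Λ : Set V) = (Λ' : Set W)) (B : Set W) :
    Λ.haar (φ ⁻¹' B) = Λ'.haar B := by
  rw [← Λ.map_haar_eq_haar Λ' φ hφ, map_haar_apply]

/-- Log form of the transport: `μ^log_{Λ'}(φ(A)) = μ^log_Λ(A)`. [cite: DupuyHilado2025, §4.7] -/
theorem logVolume_image_equiv (φ : V ≃ₜ+ W) (hφ : φ '' (Λ : Set V) = (Λ' : Set W)) (A : Set V) :
    Λ'.logVolume (φ '' A) = Λ.logVolume A := by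
  simp only [logVolume, Λ.haar_image_equiv Λ' φ hφ]

/-- Normalised log form of the transport (same weight on both sides, e.g. `dim_{ℚ_p}` of isomorphic
containers): `μ^log_{Λ'}(φ(A))/d = μ^log_Λ(A)/d`. [cite: DupuyHilado2025, §4.7] -/
theorem normalizedLogVolume_image_equiv (d : ℕ) (φ : V ≃ₜ+ W)
    (hφ : φ '' (Λ : Set V) = (Λ' : Set W)) (A : Set V) :
    Λ'.normalizedLogVolume d (φ '' A) = Λ.normalizedLogVolume d A := by
  simp only [normalizedLogVolume, Λ.logVolume_image_equiv Λ' φ hφ]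

/-! ### Automorphisms preserving some integral structure preserve every normalised volume -/

/-- **Lattice automorphisms preserve volumes, whatever the normalisation**: if `φ : V ≃ V` maps SOME
integral structure `Λ₀` onto itself, then `μ_Λ(φ(A)) = μ_Λ(A)` for every `A` and EVERY integral structure
`Λ` (`μ_Λ` is a constant multiple of `μ_{Λ₀}`, which `φ` preserves). (Ind2) in Dupuy–Hilado's reading:
"`ℤ_p`-lattice isomorphisms of `I_v`" — fixing the log-shell lattice `I_v` rather than `O_v` — "the measure
of sets are preserved under these maps". [cite: DupuyHilado2025, §4.9] -/
theorem haar_image_of_preserves (φ : V ≃ₜ+ V) (Λ₀ : IntegralStructure V)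
    (hφ : φ '' (Λ₀ : Set V) = (Λ₀ : Set V)) (A : Set V) : Λ.haar (φ '' A) = Λ.haar A := by
  rw [Λ₀.haar_eq_smul_haar Λ]
  simp only [Measure.smul_apply, smul_eq_mul, Λ₀.haar_image_of_image_eq φ hφ]

/-- In particular such a `φ` has modulus one for every normalisation: `μ_Λ(φ(Λ)) = 1`.
[cite: DupuyHilado2025, §4.9] -/
theorem haar_image_self_of_preserves (φ : V ≃ₜ+ V) (Λ₀ : IntegralStructure V)
    (hφ : φ '' (Λ₀ : Set V) = (Λ₀ : Set V)) : Λ.haar (φ '' (Λ : Set V)) = 1 := by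
  rw [Λ.haar_image_of_preserves φ Λ₀ hφ, haar_self]

/-- **The modulus does not depend on the normalising lattice**: `μ_Λ(φ(Λ)) = μ_{Λ₀}(φ(Λ₀))` for any two
integral structures `Λ`, `Λ₀` (both equal the Haar modulus of `φ`). [cite: MochizukiAbsTopIII2015, Prop. 5.7 (i)(b) p. 138] -/
theorem haar_image_self_eq (φ : V ≃ₜ+ V) (Λ₀ : IntegralStructure V) :
    Λ.haar (φ '' (Λ : Set V)) = Λ₀.haar (φ '' (Λ₀ : Set V)) := by
  have hc : Λ.haar = (Λ₀.haar (Λ : Set V))⁻¹ • Λ₀.haar := Λ₀.haar_eq_smul_haar Λ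
  have h0 : Λ₀.haar (Λ : Set V) ≠ 0 := (Λ₀.haar_pos_of_isOpen Λ.isOpen Λ.nonempty).ne'
  have ht : Λ₀.haar (Λ : Set V) ≠ ∞ := (Λ₀.haar_lt_top_of_isCompact Λ.isCompact).ne
  have hc0 : (Λ₀.haar (Λ : Set V))⁻¹ ≠ 0 := ENNReal.inv_ne_zero.mpr ht
  have hct : (Λ₀.haar (Λ : Set V))⁻¹ ≠ ∞ := ENNReal.inv_ne_top.mpr h0
  -- the scaling rule for `μ_Λ` on the set `Λ₀`, rewritten through `μ_Λ = c • μ_{Λ₀}`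
  have h1 : Λ.haar (φ '' (Λ₀ : Set V)) = Λ.haar (φ '' (Λ : Set V)) * Λ.haar (Λ₀ : Set V) :=
    Λ.haar_image φ (Λ₀ : Set V)
  have h2 : Λ.haar (φ '' (Λ₀ : Set V)) = (Λ₀.haar (Λ : Set V))⁻¹ * Λ₀.haar (φ '' (Λ₀ : Set V)) := by
    rw [hc, Measure.smul_apply, smul_eq_mul]
  have h3 : Λ.haar (Λ₀ : Set V) = (Λ₀.haar (Λ : Set V))⁻¹ := by
    rw [hc, Measure.smul_apply, smul_eq_mul, haar_self, mul_one]
  rw [h2, h3, mul_comm (Λ.haar _)] at h1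
  exact ((ENNReal.mul_right_inj hc0 hct).mp h1).symm

/-- Log form: a lattice automorphism leaves every log-volume unchanged, `μ^log_Λ(φ(A)) = μ^log_Λ(A)`
("if `x ∈ O_k^×`, then `μ^log_k(x·A) = μ^log_k(A)`", here for any `φ` fixing any lattice).
[cite: MochizukiAbsTopIII2015, Prop. 5.7 (i)(b) p. 138] -/
theorem logVolume_image_of_preserves (φ : V ≃ₜ+ V) (Λ₀ : IntegralStructure V)
    (hφ : φ '' (Λ₀ : Set V) = (Λ₀ : Set V)) (A : Set V) : Λ.logVolume (φ '' A) = Λ.logVolume A := by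
  simp only [logVolume, Λ.haar_image_of_preserves φ Λ₀ hφ]

/-- Normalised log form: `μ^log_Λ(φ(A))/d = μ^log_Λ(A)/d` for a lattice automorphism `φ`.
[cite: DupuyHilado2025, §4.9] -/
theorem normalizedLogVolume_image_of_preserves (d : ℕ) (φ : V ≃ₜ+ V) (Λ₀ : IntegralStructure V)
    (hφ : φ '' (Λ₀ : Set V) = (Λ₀ : Set V)) (A : Set V) :
    Λ.normalizedLogVolume d (φ '' A) = Λ.normalizedLogVolume d A := by
  simp only [normalizedLogVolume, Λ.logVolume_image_of_preserves φ Λ₀ hφ]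

/-! ### Negation -/

/-- **Negation preserves volumes**: `μ_Λ(−A) = μ_Λ(A)` (a regular Haar measure on an abelian group is
negation invariant; `x ↦ −x` is a lattice automorphism of every integral structure) — the sign `{±1}` in
(Ind2). [cite: DupuyHilado2025, §4.9] -/
theorem haar_neg (A : Set V) : Λ.haar (-A) = Λ.haar A := by
  haveI : LocallyCompactSpace V := Λ.locallyCompactSpace
  exact Measure.measure_neg Λ.haar A

/-- Log form: `μ^log_Λ(−A) = μ^log_Λ(A)`. [cite: DupuyHilado2025, §4.9] -/
theorem logVolume_neg (A : Set V) : Λ.logVolume (-A) = Λ.logVolume A := by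
  simp only [logVolume, Λ.haar_neg]

/-- Normalised log form: `μ^log_Λ(−A)/d = μ^log_Λ(A)/d`. [cite: DupuyHilado2025, §4.9] -/
theorem normalizedLogVolume_neg (d : ℕ) (A : Set V) :
    Λ.normalizedLogVolume d (-A) = Λ.normalizedLogVolume d A := by
  simp only [normalizedLogVolume, Λ.logVolume_neg]

/-! ### Direct product regions: factorwise lattice automorphisms -/

section Pi

variable {J : Type*} [Fintype J] {U : J → Type*} [∀ j, AddCommGroup (U j)]
  [∀ j, TopologicalSpace (U j)] [∀ j, IsTopologicalAddGroup (U j)] [∀ j, MeasurableSpace (U j)]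
  [∀ j, BorelSpace (U j)] (Λs : ∀ j, IntegralStructure (U j))

/-- **Weighted log-volumes are unchanged by factorwise lattice automorphisms**: if every `φ_j : U_j ≃ U_j`
maps some integral structure of `U_j` onto itself, then `Σ_j w_j·μ^log_j(φ_j(A_j)) = Σ_j w_j·μ^log_j(A_j)`
for every family of regions and every weight — the direct-sum form of "(Ind2) preserves the packet
log-volume" ([IUTchIII] Rmk. 3.1.1 (ii) weighted sums; Dupuy–Hilado §4.9).
[cite: DupuyHilado2025, §4.9] -/
theorem weightedLogVolume_image_of_preserves (w : J → ℝ) (φ : ∀ j, U j ≃ₜ+ U j)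
    (Λ₀ : ∀ j, IntegralStructure (U j)) (hφ : ∀ j, φ j '' (Λ₀ j : Set (U j)) = (Λ₀ j : Set (U j)))
    (A : ∀ j, Set (U j)) :
    weightedLogVolume Λs w (fun j => φ j '' A j) = weightedLogVolume Λs w A := by
  simp only [weightedLogVolume, (Λs _).logVolume_image_of_preserves (φ _) (Λ₀ _) (hφ _)]

/-- Weighted log-volumes are unchanged by factorwise negation (the lattice automorphisms `x ↦ −x`).
[cite: DupuyHilado2025, §4.9] -/
theorem weightedLogVolume_neg (w : J → ℝ) (A : ∀ j, Set (U j)) :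
    weightedLogVolume Λs w (fun j => -A j) = weightedLogVolume Λs w A := by
  simp only [weightedLogVolume, (Λs _).logVolume_neg]

end Pi

end IntegralStructure

/-! ### The volume of a nonarchimedean local field -/

section LocalField

open Metric

variable (K : Type*) [NontriviallyNormedField K] [IsUltrametricDist K] [ProperSpace K]
  [MeasurableSpace K] [BorelSpace K]
variable (K' : Type*) [NontriviallyNormedField K'] [IsUltrametricDist K'] [ProperSpace K']
  [MeasurableSpace K'] [BorelSpace K']

/-- An additive homeomorphism of `k` mapping SOME integral structure (any compact open subgroup: `O_k`, an
ideal `m_k^n`, the log-shell `p^{−m}·log(O_k^×)`, any `ℤ_p`-lattice) onto itself preserves the volume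
`μ_k`: `μ_k(φ(A)) = μ_k(A)` — Dupuy–Hilado's (Ind2) "`ℤ_p`-lattice isomorphisms of `I_v`".
[cite: DupuyHilado2025, §4.9] -/
theorem localVolume_image_of_preserves (φ : K ≃ₜ+ K) (Λ₀ : IntegralStructure K)
    (hφ : φ '' (Λ₀ : Set K) = (Λ₀ : Set K)) (A : Set K) :
    localVolume K (φ '' A) = localVolume K A :=
  (unitBallStructure K).haar_image_of_preserves φ Λ₀ hφ A

/-- Log form: `μ^log_k(φ(A)) = μ^log_k(A)` for such `φ`. [cite: DupuyHilado2025, §4.9] -/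
theorem localLogVolume_image_of_preserves (φ : K ≃ₜ+ K) (Λ₀ : IntegralStructure K)
    (hφ : φ '' (Λ₀ : Set K) = (Λ₀ : Set K)) (A : Set K) :
    localLogVolume K (φ '' A) = localLogVolume K A :=
  (unitBallStructure K).logVolume_image_of_preserves φ Λ₀ hφ A

/-- Normalised log form: `μ^log(φ(A)) = μ^log(A)` (weight `d`, e.g. `[k:ℚ_p]`) for such `φ`.
[cite: DupuyHilado2025, §4.9] -/
theorem normalizedLocalLogVolume_image_of_preserves (d : ℕ) (φ : K ≃ₜ+ K) (Λ₀ : IntegralStructure K)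
    (hφ : φ '' (Λ₀ : Set K) = (Λ₀ : Set K)) (A : Set K) :
    normalizedLocalLogVolume K d (φ '' A) = normalizedLocalLogVolume K d A := by
  simp only [normalizedLocalLogVolume, (unitBallStructure K).normalizedLogVolume_image_of_preserves d φ Λ₀ hφ]

omit [IsUltrametricDist K] [ProperSpace K] [MeasurableSpace K] [BorelSpace K]
  [IsUltrametricDist K'] [ProperSpace K'] [MeasurableSpace K'] [BorelSpace K'] in
/-- A norm-preserving additive bijection between normed fields maps the closed unit ball ONTO the closed
unit ball. [folklore] -/
private theorem image_closedBall_eq_of_norm_map_eq (φ : K ≃ₜ+ K') (hφ : ∀ x, ‖φ x‖ = ‖x‖) :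
    φ '' closedBall (0 : K) 1 = closedBall (0 : K') 1 := by
  ext y
  simp only [mem_image, mem_closedBall, dist_zero_right]
  constructor
  · rintro ⟨x, hx, rfl⟩
    rwa [hφ]
  · intro hy
    refine ⟨φ.symm y, ?_, φ.apply_symm_apply y⟩
    rw [← hφ, φ.apply_symm_apply]
    exact hy

/-- **Norm-preserving additive homeomorphisms preserve the volume**: if `‖φ(x)‖ = ‖x‖` for all `x`
(e.g. multiplication by a unit, a continuous field automorphism that is an isometry, `x ↦ −x`), then
`μ_k(φ(A)) = μ_k(A)` ("if `x ∈ O_k^×`, then `μ^log_k(x·A) = μ^log_k(A)`").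
[cite: MochizukiAbsTopIII2015, Prop. 5.7 (i)(b) p. 138] -/
theorem localVolume_image_of_norm_map_eq (φ : K ≃ₜ+ K) (hφ : ∀ x, ‖φ x‖ = ‖x‖) (A : Set K) :
    localVolume K (φ '' A) = localVolume K A :=
  (unitBallStructure K).haar_image_of_image_eq φ (image_closedBall_eq_of_norm_map_eq K K φ hφ) A

/-- Log form: `μ^log_k(φ(A)) = μ^log_k(A)` for a norm-preserving `φ`.
[cite: MochizukiAbsTopIII2015, Prop. 5.7 (i)(b) p. 138] -/
theorem localLogVolume_image_of_norm_map_eq (φ : K ≃ₜ+ K) (hφ : ∀ x, ‖φ x‖ = ‖x‖) (A : Set K) :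
    localLogVolume K (φ '' A) = localLogVolume K A :=
  (unitBallStructure K).logVolume_image_of_image_eq φ (image_closedBall_eq_of_norm_map_eq K K φ hφ) A

/-- **Transport between two local fields**: an additive homeomorphism `φ : k ≃ k'` with `‖φ(x)‖ = ‖x‖`
(e.g. a continuous isomorphism of valued fields) carries `μ_k` to `μ_{k'}`: `μ_{k'}(φ(A)) = μ_k(A)` —
the local-field case of [IUTchIII] Prop. 3.9 (ii) "compatible … relative to the natural
poly-isomorphisms" / (Ind1)'s strip isomorphisms. [cite: DupuyHilado2025, §4.7] -/
theorem localVolume_image_equiv_of_norm_map_eq (φ : K ≃ₜ+ K') (hφ : ∀ x, ‖φ x‖ = ‖x‖) (A : Set K) :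
    localVolume K' (φ '' A) = localVolume K A :=
  (unitBallStructure K).haar_image_equiv (unitBallStructure K') φ
    (image_closedBall_eq_of_norm_map_eq K K' φ hφ) A

/-- Log form of the transport between two local fields: `μ^log_{k'}(φ(A)) = μ^log_k(A)`.
[cite: DupuyHilado2025, §4.7] -/
theorem localLogVolume_image_equiv_of_norm_map_eq (φ : K ≃ₜ+ K') (hφ : ∀ x, ‖φ x‖ = ‖x‖)
    (A : Set K) : localLogVolume K' (φ '' A) = localLogVolume K A :=
  (unitBallStructure K).logVolume_image_equiv (unitBallStructure K') φ
    (image_closedBall_eq_of_norm_map_eq K K' φ hφ) A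

/-- Normalised log form of the transport (same weight `d = [k:ℚ_p] = [k':ℚ_p]` for isomorphic fields).
[cite: DupuyHilado2025, §4.7] -/
theorem normalizedLocalLogVolume_image_equiv_of_norm_map_eq (d : ℕ) (φ : K ≃ₜ+ K')
    (hφ : ∀ x, ‖φ x‖ = ‖x‖) (A : Set K) :
    normalizedLocalLogVolume K' d (φ '' A) = normalizedLocalLogVolume K d A := by
  simp only [normalizedLocalLogVolume, (unitBallStructure K).normalizedLogVolume_image_equiv
    (unitBallStructure K') d φ (image_closedBall_eq_of_norm_map_eq K K' φ hφ)]

/-- Negation preserves the volume of a local field: `μ_k(−A) = μ_k(A)` (`−1 ∈ O_k^×`: "if `x ∈ O_k^×`, then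
`μ^log_k(x·A) = μ^log_k(A)`"). [cite: MochizukiAbsTopIII2015, Prop. 5.7 (i)(b) p. 138] -/
theorem localVolume_neg (A : Set K) : localVolume K (-A) = localVolume K A :=
  (unitBallStructure K).haar_neg A

/-- Log form: `μ^log_k(−A) = μ^log_k(A)`. [cite: MochizukiAbsTopIII2015, Prop. 5.7 (i)(b) p. 138] -/
theorem localLogVolume_neg (A : Set K) : localLogVolume K (-A) = localLogVolume K A :=
  (unitBallStructure K).logVolume_neg A

end LocalField

end Literature.IUT.LogVolume

end
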